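import Summits.ResolutionOfSingularities.ResolutionOfSingularities.Theorems.FrobeniusLadderFRationalResolutionMonomialAlgebraCompletion
import Summits.ResolutionOfSingularities.ResolutionOfSingularities.Theorems.FrobeniusLadderFRationalResolutionVeroneseSingularLocus
import HarnessLib

/-!
# Crux `FrobeniusLadder.FRationalResolution` (stmt-ResolutionOfSingularities-15317), line `redirect`,
# stub `stub_diagonalizableQuotientResolution` — TWISTED VERONESE POINTS: `hloc` FROM `κ⟦P⟧ ≅ Ê` ALONE

The cone programme proved `Bl_{VM} Spec κ[χᵈ : |d| = r]` regular (`veroneseCone_isRegular_affineBlowup`, p807148) for the Veronese cone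
`V(n,r)` — the toric model of the isolated quotient singularity `1/r(1,…,1)` in every dimension and characteristic (wild `p ∣ r` included).
With `…MonomialAlgebraCompletion.hloc_of_ringEquiv_monoidPowerSeries` ((E″): `(κ[χᵈ : |d| = r]_𝔳)^ ≅ κ⟦P⟧`, `P = ⟨d : |d| = r⟩`):

★★★ `hloc_of_ringEquiv_monoidPowerSeries_veronese` — Galois data at a twisted isolated point + a ring isomorphism `κ⟦P⟧ ≃+* Ê`,
`P = ⟨d : |d| = r⟩ ⊆ ℕⁿ` (`r ≥ 1`), ⇒ `hloc` at the point.

So for the twisted forms of `1/r(1,…,1)` in any dimension NOTHING is left but d = 0 Kato chart data on `Ê` by `P`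
(`…HfinOfChartData.exists_ringEquiv_monoidPowerSeries_of_chartData`). Honest label: assembly toward ONE leaf stub (no stub, crux or
summit closed). No definitions, no named facts, no sorry. [cite: Kollar2007, §2.2] [cite: Kato1994, Thm. (3.2)]
[cite: Matsumura1987, Thm. 8.11; §32 p. 256]
-/

noncomputable section

-- single-problem summit: the doubled namespace component is forced
set_option linter.dupNamespace false

open CategoryTheory AlgebraicGeometry TopologicalSpace TensorProduct
open IsLocalRing Literature.RingTheory.MvPowerSeries Literature.RingTheory.MvPowerSeries.monoidPowerSeries
open Literature.AlgebraicGeometry.Resolution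

namespace Summit.ResolutionOfSingularities.ResolutionOfSingularities.Theorems.FRationalResolution.MonomialAlgebraCompletion

/-- ★★★ **TWISTED VERONESE POINTS.** Galois data at a twisted isolated point as in p839495/p840407 and a ring isomorphism
`κ⟦P⟧ ≃+* Ê` with `P = ⟨d : |d| = r⟩ ⊆ ℕⁿ`, `r ≥ 1` (the exponent monoid of the Veronese cone `V(n,r) = 𝔸ⁿ/μ_r`): then `hloc` holds at
the point. [cite: Kollar2007, §2.2] [cite: Kato1994, Thm. (3.2)] [cite: Matsumura1987, Thm. 8.11; §32 p. 256] -/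
theorem hloc_of_ringEquiv_monoidPowerSeries_veronese (K : Type) [Field K] (X : Scheme.{0}) [IsIntegral X]
    (f : X ⟶ Spec (.of K)) [LocallyOfFiniteType f]
    {B : Type} [CommRing B] [IsDomain B] [Algebra K B] [Algebra.FiniteType K B]
    (ι : Spec (.of B) ⟶ X) [IsOpenImmersion ι] (hι : ι ≫ f = Spec.map (CommRingCat.ofHom (algebraMap K B)))
    (𝔭 : Ideal B) [h𝔭 : 𝔭.IsMaximal] (h𝔭0 : 𝔭 ≠ ⊥)
    (hsing : ι ⟨𝔭, h𝔭.isPrime⟩ ∉ Scheme.regularLocus X)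
    (hregB : ∀ P : Spec (.of B), P.asIdeal ≠ 𝔭 → P ∈ Scheme.regularLocus (Spec (.of B)))
    (K' : Type) [Field K'] [Algebra K K'] [FiniteDimensional K K'] [IsGalois K K']
    (𝔔' : Ideal (B ⊗[K] K')) [h𝔔' : 𝔔'.IsMaximal] (h𝔔'𝔭 : 𝔔'.comap (algebraMap B (B ⊗[K] K')) = 𝔭)
    (κ : Type) [Field κ] (n r : ℕ) (hr : 1 ≤ r) (P : AddSubmonoid (Fin n →₀ ℕ))
    (hP : AddSubmonoid.closure {d : Fin n →₀ ℕ | Finsupp.degree d = r} = P)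
    (e : ↥(monoidPowerSeries κ P) ≃+*
      AdicCompletion (maximalIdeal (Localization.AtPrime 𝔔')) (Localization.AtPrime 𝔔')) :
    ∃ (V : X.Opens), ι ⟨𝔭, h𝔭.isPrime⟩ ∈ V ∧
      (∀ t : X, t ∉ Scheme.regularLocus X → t ∈ V → t = ι ⟨𝔭, h𝔭.isPrime⟩) ∧
      ∃ (Y : Scheme.{0}) (ρ : Y ⟶ V), IsProper ρ ∧ Scheme.IsRegular Y ∧
        IsIso (ρ ∣_ (V.ι ⁻¹ᵁ ⟨Scheme.regularLocus X, isOpen_regularLocus_of_locallyOfFiniteType_field f⟩)) ∧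
        Dense ((ρ ⁻¹ᵁ (V.ι ⁻¹ᵁ ⟨Scheme.regularLocus X,
          isOpen_regularLocus_of_locallyOfFiniteType_field f⟩) : Y.Opens) : Set Y) := by
  have hS : ({d : Fin n →₀ ℕ | Finsupp.degree d = r}).Finite :=
    (Finsupp.finite_of_degree_le r).subset fun d hd => le_of_eq hd
  have h0 : (0 : Fin n →₀ ℕ) ∉ {d : Fin n →₀ ℕ | Finsupp.degree d = r} := by
    simp only [Set.mem_setOf_eq, map_zero]
    omega
  haveI := MonomialAlgebraVertex.vertexIdeal_isMaximal κ _ h0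
  exact hloc_of_ringEquiv_monoidPowerSeries κ K X f ι hι 𝔭 h𝔭0 hsing hregB K' 𝔔' h𝔔'𝔭
    {d : Fin n →₀ ℕ | Finsupp.degree d = r} hS h0 P hP (veroneseCone_isRegular_affineBlowup κ n r hr) e

end Summit.ResolutionOfSingularities.ResolutionOfSingularities.Theorems.FRationalResolution.MonomialAlgebraCompletion

end
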